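import Summits.QuantumFields.BalabanUV.Beta.TameKernelCalculus

/-!
# `BalabanUV.Beta.ChartConjugation` — THE ASSEMBLED ONE-LOOP JETS ARE BLIND TO AN INFINITESIMAL ORTHOGONAL RE-CHARTING OF THE
# BORDERED HESSIAN: the kernel-level twin of an2's matrix certificate `jet₂_congruence_orthogonal` (β sub-cell, row BETA-an5, gen 18;
# file 2 of 3 — the defect identity; file 3 `ChartConjugationEnd` carries the reflection law and the `hR` END re-stated over the
# conjugated sockets)

HONEST FRAMING (cell contract, verbatim): «discharging `BetaPertH` makes Bałaban's UV stability UNCONDITIONAL — a real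
constructive-QFT result; it is NOT the continuum limit and NOT the Clay problem.»  THIS MODULE is elementary analysis on matrix-fibred
lattice kernels (absolutely convergent compositions and traces): it formalises NO statement printed in Bałaban's papers, cites none as a
hypothesis, mints no `Prop` fact (four `def`s of OBJECTS — the contact kernels), instantiates NO binder of the wall and DISCHARGES NOTHING
of it.  NOT summit progress.

ABSOLUTE RULE (cell, verbatim): «No internally-minted statement may enter as a cited fact. Every hypothesis is either
kernel-proved in this package or a verbatim quotation of a PUBLISHED theorem with page reference. The manuscript(s) under
audit are NOT citable for their own disputed steps — they are the thing under adjudication; programme-internal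
(2001/route/tribunal) claims are never citable.»  Every theorem below is kernel-proved from explicit, abstract hypotheses.

PLACEMENT.  New cell work (our own lemmas about the cell's typed objects — β-lead RULINGS (R34-A), (R33-A-2′) «placement of (iii)/(iv):
`Summits/QuantumFields/BalabanUV/Beta/ChartConjugation.lean` (+ `…End.lean`)»), under the registered cell topic; it IMPORTS the cell's
`Literature/…/Balaban1983to89/Beta/` leaves (via `TameKernelCalculus`) and is imported by nothing under `Literature/`.  ≤ 400 lines each.

WHY.  β-lead RULING (R33-A) adopted the PRODUCT CHART ((R25-2)): under the reflection of one axis the centred one-step jets obey the laws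
(Sr)/(Wr) WITH CONJUGATION — the stencil at a reflected bond is the transported stencil PLUS a first-order contact `A_bᵀ𝕄₀ + 𝕄₀A_b`
(`𝕄₀` the bordered Hessian, `A_b` the jet of the bond-diagonal, Killing-orthogonal re-charting `D(B) = ⊕_b Ad(e^{−B_b})`), and the
second-order table acquires the nine-term product-rule contact (an2-g11, X-an2-40 v1.1 §2; the V–H block of the first-order contact is
`RootedKernelReflection.ctE` / `vhSAt_bref`, countersigned (R33-A-1)).  an2's MATRIX certificate `AssembledJetChartCovariance.jet₂_defect` /
`jet₂_congruence_orthogonal` shows that the ASSEMBLED one-loop jets `tr(K S_b)`, `tr(K W_bc) − tr(K S_b K S_c)` are blind to such contacts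
when `K = 𝕄₀⁻¹`.  THIS FILE is that certificate AT KERNEL LEVEL — infinite lattice, absolutely convergent `ExpKernelCalculus.comp` / `tr`
— i.e. item (iii) of X-an2-40 §5 / (R33-A-2′), with every Fubini, cyclicity and re-association step made honest (`TameKernelCalculus`).

CONTENT.  §1 THE CONTACTS in commutator form — `conjV 𝕄 X := 𝕄∘X − X∘𝕄` (= `Xᵀ𝕄 + 𝕄X` for skew `X`), `conjW 𝕄 V V′ X X′ X₂ := conjW₁ + conjW₂`,
`conjW₁ := [V′,X] + [V,X′]`, `conjW₂ := (XX′ + X′X)𝕄 − (X𝕄X′ + X′𝕄X) + [𝕄,X₂]` (an2's nine-term contact with skewness and the orthogonality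
jet relation `X₂ᵀ + X₂ + XᵀX′ + X′ᵀX = 0` PRE-APPLIED); their `Loc`-closure.  §2 THE DEFECT IDENTITY **`conj_defect`**: for `A`, `𝕄` spread
with `comp A 𝕄 = idK`, `comp 𝕄 A = idK` AS BINDERS (`HessKerSchurResolvent.idK`; the `hinvL/hinvR` convention of the tree) and localised
`V, V′, X, X′, X₂`: `tadpole A (conjW …) = bubble A (conjV 𝕄 X) V′ + bubble A V (conjV 𝕄 X′) + bubble A (conjV 𝕄 X) (conjV 𝕄 X′)`, via the
SANDWICH `(A∘conjV 𝕄 X)∘(A∘Z) = X∘(A∘Z) − (A∘X)∘Z` (= `KernelWard.ward_hess`'s (W1)/(W2) mechanism with generator `−X`) for the first-order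
part and four cyclic re-associations through `A∘𝕄 = 𝕄∘A = 1` for the quadratic part (`[𝕄,X₂]` has zero tadpole); hence
**`hess_conj_invariant`**: `½·tadpole A (W + conjW …) − ½·bubble A (V + conjV 𝕄 X) (V′ + conjV 𝕄 X′) = ½·tadpole A W − ½·bubble A V V′` — NO
skewness / orthogonality hypothesis in the commutator form.  §3 an2's TRANSPOSE LETTERS: with `Xᵀ = −X`, `X′ᵀ = −X′` and the orthogonality
relation, `Xᵀ𝕄 + 𝕄X = conjV 𝕄 X` (`conjV_eq_transpose`), the nine-term table `= conjW` (`conjW_eq_transpose`), and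
`hess_conj_invariant_transpose`.  §4 relabelling in `Loc` currency: `tadpole_refK_loc`, `bubble_refK_loc`.

RELATION TO THE TREE (no duplication): all analysis is `TameKernelCalculus` (corollaries of `KernelWard` / `ExpKernelCalculus` bricks BY
NAME); `HessKerSchurResolvent.idK`, `comp_idK_left/right`.  an2's matrix certificate (`AssembledJetChartCovariance`, p195393) is the
finite-dimensional shadow of §2 and is not imported.  NOT continuum, NOT Clay.
-/

open Finset
open scoped BigOperators
open Literature.MathematicalPhysics.QuantumFieldTheory.Balaban1983to89
open Literature.MathematicalPhysics.QuantumFieldTheory.Balaban1983to89.Beta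
open ExpKernelCalculus (MKer Decays BiLoc comp tr bubble tadpole)
open HessKerSchurResolvent (idK comp_idK_left comp_idK_right)
open KernelReflection (LegMap refK comp_refK tr_refK summable_trSlice)
open Summit.QuantumFields.BalabanUV.Beta.TameKernelCalculus

namespace Summit.QuantumFields.BalabanUV.Beta.ChartConjugation

noncomputable section

variable {D : ℕ} {F : Type*} [Fintype F]

/-! ## §1 The contacts in commutator form -/

omit [Fintype F] in
/-- FIRST-ORDER CONTACT (commutator form): `conjV 𝕄 X := 𝕄∘X − X∘𝕄`; for a skew generator `Xᵀ = −X` this IS an2's `Xᵀ𝕄 + 𝕄X`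
(`conjV_eq_transpose`).  In (Sr-conj): `X = A_b`, the jet of the bond-diagonal orthogonal re-charting at the bond `b`. -/
def conjV (M X : MKer D F) : MKer D F := comp M X - comp X M

omit [Fintype F] in
/-- FIRST-ORDER PIECE of the second-order contact at the bond pair `(b, c)`: `[V′, X] + [V, X′]` (`V, X` at `b`; `V′, X′` at `c`) —
an2's `A_bᵀS_c + S_cA_b + A_cᵀS_b + S_bA_c` for skew generators. -/
def conjW₁ (V Vp X Xp : MKer D F) : MKer D F := (comp Vp X - comp X Vp) + (comp V Xp - comp Xp V)

omit [Fintype F] in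
/-- QUADRATIC PIECE of the second-order contact: `(XX′ + X′X)𝕄 − (X𝕄X′ + X′𝕄X) + [𝕄, X₂]` — an2's
`A_bᵀ𝕄A_c + A_cᵀ𝕄A_b + A_bcᵀ𝕄 + 𝕄A_bc` with skewness and the orthogonality jet relation `A_bcᵀ = −A_bc + A_bA_c + A_cA_b` PRE-APPLIED
(`conjW_eq_transpose`); triple products LEFT-associated (`comp_assoc_tame` re-associates at will). -/
def conjW₂ (M X Xp X₂ : MKer D F) : MKer D F :=
  (comp (comp X Xp) M + comp (comp Xp X) M) - (comp (comp X M) Xp + comp (comp Xp M) X) + (comp M X₂ - comp X₂ M)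

omit [Fintype F] in
/-- THE SECOND-ORDER CONTACT `conjW := conjW₁ + conjW₂` (the (Wr-conj) contact minus the transported table). -/
def conjW (M V Vp X Xp X₂ : MKer D F) : MKer D F := conjW₁ V Vp X Xp + conjW₂ M X Xp X₂

/-- The first-order contact of a spread chart inverse and a localised generator is localised. -/
theorem loc_conjV {M X : MKer D F} (hM : Spr M) (hX : Loc X) : Loc (conjV M X) := (hM.comp_loc hX).sub (hX.comp_spr hM)

/-- `conjW₁` of localised letters is localised. -/
theorem loc_conjW₁ {V Vp X Xp : MKer D F} (hV : Loc V) (hVp : Loc Vp) (hX : Loc X) (hXp : Loc Xp) : Loc (conjW₁ V Vp X Xp) :=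
  ((hVp.comp hX).sub (hX.comp hVp)).add ((hV.comp hXp).sub (hXp.comp hV))

/-- `conjW₂` of localised letters (and a spread `M`) is localised. -/
theorem loc_conjW₂ {M X Xp X₂ : MKer D F} (hM : Spr M) (hX : Loc X) (hXp : Loc Xp) (hX₂ : Loc X₂) : Loc (conjW₂ M X Xp X₂) :=
  ((((hX.comp hXp).comp_spr hM).add ((hXp.comp hX).comp_spr hM)).sub
    (((hX.comp_spr hM).comp hXp).add ((hXp.comp_spr hM).comp hX))).add ((hM.comp_loc hX₂).sub (hX₂.comp_spr hM))

/-- The second-order contact `conjW` of localised letters is localised. -/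
theorem loc_conjW {M V Vp X Xp X₂ : MKer D F} (hM : Spr M) (hV : Loc V) (hVp : Loc Vp) (hX : Loc X) (hXp : Loc Xp) (hX₂ : Loc X₂) :
    Loc (conjW M V Vp X Xp X₂) := (loc_conjW₁ hV hVp hX hXp).add (loc_conjW₂ hM hX hXp hX₂)

/-! ## §2 The defect identity and the invariance of the assembled one-loop Hessian form -/

section Defect

variable [DecidableEq F] {A M : MKer D F}

/-- `A ∘ conjV 𝕄 X = X − (A∘X)∘𝕄` (uses `A∘𝕄 = 1`). -/
theorem comp_conjV (hA : Spr A) (hM : Spr M) (hAM : comp A M = idK) {X : MKer D F} (hX : Loc X) :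
    comp A (conjV M X) = X - comp (comp A X) M := by
  unfold conjV
  rw [comp_sub_right_tame hA.tame (hM.comp_loc hX).tame (hX.comp_spr hM).tame, comp_assoc_tame hA.tame hM.tame hX.tame, hAM,
    comp_idK_left, comp_assoc_tame hA.tame hX.tame hM.tame]

/-- THE SANDWICH IDENTITY `(A ∘ conjV 𝕄 X) ∘ (A ∘ Z) = X ∘ (A∘Z) − (A∘X) ∘ Z` (uses both `A∘𝕄 = 1` and `𝕄∘A = 1`): the mechanism of
`KernelWard.ward_hess` (W1)/(W2) with generator `−X`. -/
theorem sandwich (hA : Spr A) (hM : Spr M) (hAM : comp A M = idK) (hMA : comp M A = idK) {X Z : MKer D F} (hX : Loc X) (hZ : Loc Z) :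
    comp (comp A (conjV M X)) (comp A Z) = comp X (comp A Z) - comp (comp A X) Z := by
  rw [comp_conjV hA hM hAM hX, comp_sub_left_tame hX.tame ((hA.comp_loc hX).comp_spr hM).tame (hA.comp_loc hZ).tame,
    ← comp_assoc_tame (hA.comp_loc hX).tame hM.tame (hA.comp_loc hZ).tame, comp_assoc_tame hM.tame hA.tame hZ.tame, hMA,
    comp_idK_left]

/-- Bubble with a first-slot contact: `bubble A (conjV 𝕄 X) Z = tr(X∘(A∘Z)) − tr((A∘X)∘Z)`. -/
theorem bubble_conjV_left (hA : Spr A) (hM : Spr M) (hAM : comp A M = idK) (hMA : comp M A = idK) {X Z : MKer D F}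
    (hX : Loc X) (hZ : Loc Z) : bubble A (conjV M X) Z = tr (comp X (comp A Z)) - tr (comp (comp A X) Z) := by
  unfold ExpKernelCalculus.bubble
  rw [sandwich hA hM hAM hMA hX hZ, tr_sub_loc (hX.comp (hA.comp_loc hZ)) ((hA.comp_loc hX).comp hZ)]

/-- Bubble with a second-slot contact: `bubble A Y (conjV 𝕄 X′) = tr((A∘Y)∘X′) − tr((A∘X′)∘Y)`. -/
theorem bubble_conjV_right (hA : Spr A) (hM : Spr M) (hAM : comp A M = idK) (hMA : comp M A = idK) {Y Xp : MKer D F}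
    (hY : Loc Y) (hXp : Loc Xp) : bubble A Y (conjV M Xp) = tr (comp (comp A Y) Xp) - tr (comp (comp A Xp) Y) := by
  unfold ExpKernelCalculus.bubble
  rw [tr_comp_comm_loc (hA.comp_loc hY) (hA.comp_loc (loc_conjV hM hXp)).tame, sandwich hA hM hAM hMA hXp hY,
    tr_sub_loc (hXp.comp (hA.comp_loc hY)) ((hA.comp_loc hXp).comp hY), tr_comp_comm_loc hXp (hA.comp_loc hY).tame]

omit [DecidableEq F] in
/-- Tadpole of a commutator pair: `tadpole A (Y∘X − X∘Y) = tr((A∘Y)∘X) − tr((A∘X)∘Y)`. -/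
theorem tadpole_comm_pair (hA : Spr A) {Y X : MKer D F} (hY : Loc Y) (hX : Loc X) :
    tadpole A (comp Y X - comp X Y) = tr (comp (comp A Y) X) - tr (comp (comp A X) Y) := by
  unfold ExpKernelCalculus.tadpole
  rw [comp_sub_right_tame hA.tame (hY.comp hX).tame (hX.comp hY).tame, tr_sub_loc (hA.comp_loc (hY.comp hX)) (hA.comp_loc (hX.comp hY)),
    comp_assoc_tame hA.tame hY.tame hX.tame, comp_assoc_tame hA.tame hX.tame hY.tame]

/-- FIRST-ORDER DEFECT: `tadpole A (conjW₁ V V′ X X′) = bubble A (conjV 𝕄 X) V′ + bubble A V (conjV 𝕄 X′)`. -/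
theorem tadpole_conjW₁ (hA : Spr A) (hM : Spr M) (hAM : comp A M = idK) (hMA : comp M A = idK) {V Vp X Xp : MKer D F}
    (hV : Loc V) (hVp : Loc Vp) (hX : Loc X) (hXp : Loc Xp) :
    tadpole A (conjW₁ V Vp X Xp) = bubble A (conjV M X) Vp + bubble A V (conjV M Xp) := by
  unfold conjW₁
  rw [tadpole_add hA ((hVp.comp hX).sub (hX.comp hVp)) ((hV.comp hXp).sub (hXp.comp hV)), tadpole_comm_pair hA hVp hX,
    tadpole_comm_pair hA hV hXp, bubble_conjV_left hA hM hAM hMA hX hVp, bubble_conjV_right hA hM hAM hMA hV hXp,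
    tr_comp_comm_loc (hA.comp_loc hVp) hX.tame]

/-- QUADRATIC DEFECT: `tadpole A (conjW₂ 𝕄 X X′ X₂) = bubble A (conjV 𝕄 X) (conjV 𝕄 X′)` — the `[𝕄, X₂]` part has zero tadpole and
the rest is four cyclic re-associations through `A∘𝕄 = 𝕄∘A = 1`. -/
theorem tadpole_conjW₂ (hA : Spr A) (hM : Spr M) (hAM : comp A M = idK) (hMA : comp M A = idK) {X Xp X₂ : MKer D F}
    (hX : Loc X) (hXp : Loc Xp) (hX₂ : Loc X₂) : tadpole A (conjW₂ M X Xp X₂) = bubble A (conjV M X) (conjV M Xp) := by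
  have hXXp := hX.comp hXp
  have hXpX := hXp.comp hX
  have hXM := hX.comp_spr hM
  have hXpM := hXp.comp_spr hM
  have hAX := hA.comp_loc hX
  have hAXp := hA.comp_loc hXp
  have hMXp := hM.comp_loc hXp
  have hMX₂ := hM.comp_loc hX₂
  have hX₂M := hX₂.comp_spr hM
  have hAXpM := hAXp.comp_spr hM
  have hP := (hXXp.comp_spr hM).add (hXpX.comp_spr hM)
  have hQ := (hXM.comp hXp).add (hXpM.comp hX)
  -- the right-hand side
  rw [bubble_conjV_left hA hM hAM hMA hX (loc_conjV hM hXp), comp_conjV hA hM hAM hXp]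
  unfold conjV
  rw [comp_sub_right_tame hX.tame hXp.tame hAXpM.tame, tr_sub_loc hXXp (hX.comp hAXpM),
    comp_sub_right_tame hAX.tame hMXp.tame hXpM.tame, tr_sub_loc (hAX.comp hMXp) (hAX.comp hXpM)]
  -- the left-hand side
  unfold conjW₂ ExpKernelCalculus.tadpole
  rw [comp_add_right_tame hA.tame (hP.sub hQ).tame (hMX₂.sub hX₂M).tame, tr_add_loc (hA.comp_loc (hP.sub hQ)) (hA.comp_loc (hMX₂.sub hX₂M)),
    comp_sub_right_tame hA.tame hP.tame hQ.tame, tr_sub_loc (hA.comp_loc hP) (hA.comp_loc hQ),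
    comp_add_right_tame hA.tame (hXXp.comp_spr hM).tame (hXpX.comp_spr hM).tame,
    tr_add_loc (hA.comp_loc (hXXp.comp_spr hM)) (hA.comp_loc (hXpX.comp_spr hM)),
    comp_add_right_tame hA.tame (hXM.comp hXp).tame (hXpM.comp hX).tame, tr_add_loc (hA.comp_loc (hXM.comp hXp)) (hA.comp_loc (hXpM.comp hX)),
    comp_sub_right_tame hA.tame hMX₂.tame hX₂M.tame, tr_sub_loc (hA.comp_loc hMX₂) (hA.comp_loc hX₂M)]
  have e1 : tr (comp A (comp (comp X Xp) M)) = tr (comp X Xp) := by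
    rw [← tr_comp_comm_loc (hXXp.comp_spr hM) hA.tame, ← comp_assoc_tame hXXp.tame hM.tame hA.tame, hMA, comp_idK_right]
  have e2 : tr (comp A (comp (comp Xp X) M)) = tr (comp Xp X) := by
    rw [← tr_comp_comm_loc (hXpX.comp_spr hM) hA.tame, ← comp_assoc_tame hXpX.tame hM.tame hA.tame, hMA, comp_idK_right]
  have e3 : tr (comp A (comp (comp X M) Xp)) = tr (comp (comp A X) (comp M Xp)) := by
    rw [comp_assoc_tame hA.tame hXM.tame hXp.tame, comp_assoc_tame hA.tame hX.tame hM.tame, ← comp_assoc_tame hAX.tame hM.tame hXp.tame]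
  have e4 : tr (comp A (comp (comp Xp M) X)) = tr (comp X (comp (comp A Xp) M)) := by
    rw [comp_assoc_tame hA.tame hXpM.tame hX.tame, comp_assoc_tame hA.tame hXp.tame hM.tame, ← tr_comp_comm_loc hX hAXpM.tame]
  have e5 : tr (comp A (comp M X₂)) = tr X₂ := by
    rw [comp_assoc_tame hA.tame hM.tame hX₂.tame, hAM, comp_idK_left]
  have e6 : tr (comp A (comp X₂ M)) = tr X₂ := by
    rw [← tr_comp_comm_loc hX₂M hA.tame, ← comp_assoc_tame hX₂.tame hM.tame hA.tame, hMA, comp_idK_right]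
  have e7 : tr (comp (comp A X) (comp Xp M)) = tr (comp Xp X) := by
    rw [tr_comp_comm_loc hAX hXpM.tame, ← comp_assoc_tame hXp.tame hM.tame hAX.tame, comp_assoc_tame hM.tame hA.tame hX.tame, hMA,
      comp_idK_left]
  rw [e1, e2, e3, e4, e5, e6, e7]
  ring

/-- **THE DEFECT IDENTITY** (kernel-level `jet₂_defect` for the orthogonal congruence): the tadpole of the second-order contact equals
the contact part of the bubble — `tadpole A (conjW …) = bubble A (conjV 𝕄 X) V′ + bubble A V (conjV 𝕄 X′) + bubble A (conjV 𝕄 X) (conjV 𝕄 X′)`. -/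
theorem conj_defect (hA : Spr A) (hM : Spr M) (hAM : comp A M = idK) (hMA : comp M A = idK) {V Vp X Xp X₂ : MKer D F}
    (hV : Loc V) (hVp : Loc Vp) (hX : Loc X) (hXp : Loc Xp) (hX₂ : Loc X₂) :
    tadpole A (conjW M V Vp X Xp X₂) =
      bubble A (conjV M X) Vp + bubble A V (conjV M Xp) + bubble A (conjV M X) (conjV M Xp) := by
  unfold conjW
  rw [tadpole_add hA (loc_conjW₁ hV hVp hX hXp) (loc_conjW₂ hM hX hXp hX₂), tadpole_conjW₁ hA hM hAM hMA hV hVp hX hXp,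
    tadpole_conjW₂ hA hM hAM hMA hX hXp hX₂]

/-- **THE ASSEMBLED ONE-LOOP HESSIAN FORM IS INVARIANT UNDER CHART CONJUGATION** (kernel-level `jet₂_congruence_orthogonal`):
`½·tadpole A (W + conjW 𝕄 V V′ X X′ X₂) − ½·bubble A (V + conjV 𝕄 X) (V′ + conjV 𝕄 X′) = ½·tadpole A W − ½·bubble A V V′`
for spread `A`, `𝕄` with `A∘𝕄 = 𝕄∘A = 1` (BINDERS) and localised `V, V′, W, X, X′, X₂` — no skewness or orthogonality hypothesis in this form. -/
theorem hess_conj_invariant (hA : Spr A) (hM : Spr M) (hAM : comp A M = idK) (hMA : comp M A = idK) {V Vp W X Xp X₂ : MKer D F}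
    (hV : Loc V) (hVp : Loc Vp) (hW : Loc W) (hX : Loc X) (hXp : Loc Xp) (hX₂ : Loc X₂) :
    (1 / 2 : ℝ) * tadpole A (W + conjW M V Vp X Xp X₂) - (1 / 2 : ℝ) * bubble A (V + conjV M X) (Vp + conjV M Xp)
      = (1 / 2 : ℝ) * tadpole A W - (1 / 2 : ℝ) * bubble A V Vp := by
  have hcV := loc_conjV hM hX
  have hcVp := loc_conjV hM hXp
  rw [tadpole_add hA hW (loc_conjW hM hV hVp hX hXp hX₂), bubble_add_left hA hV hcV (hVp.add hcVp), bubble_add_right hA hV hVp hcVp,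
    bubble_add_right hA hcV hVp hcVp, conj_defect hA hM hAM hMA hV hVp hX hXp hX₂]
  ring

end Defect

/-! ## §3 The transpose form (an2's letters): skewness and the orthogonality jet relation identify it with the commutator form -/

/-- For a skew generator, `Xᵀ𝕄 + 𝕄X = conjV 𝕄 X`. -/
theorem conjV_eq_transpose (M : MKer D F) {X : MKer D F} (hskew : trK X = -X) : comp (trK X) M + comp M X = conjV M X := by
  rw [hskew, comp_neg_left, conjV]
  abel

/-- For skew generators `X, X′` and `X₂` with the ORTHOGONALITY JET RELATION `X₂ᵀ + X₂ + XᵀX′ + X′ᵀX = 0` (the second jet of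
`D(B)ᵀD(B) = 1` at the bond pair), an2's nine-term contact (minus the transported table) IS `conjW`. -/
theorem conjW_eq_transpose {M V Vp X Xp X₂ : MKer D F} (hM : Spr M) (hX : Loc X) (hXp : Loc Xp) (hX₂ : Loc X₂)
    (hskew : trK X = -X) (hskew' : trK Xp = -Xp) (horth : trK X₂ + X₂ + comp (trK X) Xp + comp (trK Xp) X = 0) :
    comp (trK X) Vp + comp Vp X + comp (trK Xp) V + comp V Xp + comp (comp (trK X) M) Xp + comp (comp (trK Xp) M) X
      + comp (trK X₂) M + comp M X₂ = conjW M V Vp X Xp X₂ := by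
  have h2 : trK X₂ = -X₂ + comp X Xp + comp Xp X := by
    rw [hskew, hskew', comp_neg_left, comp_neg_left] at horth
    rw [← sub_eq_zero, ← horth]
    abel
  rw [h2, hskew, hskew', comp_add_left_tame (hX₂.neg.add (hX.comp hXp)).tame (hXp.comp hX).tame hM.tame,
    comp_add_left_tame hX₂.neg.tame (hX.comp hXp).tame hM.tame]
  simp only [comp_neg_left]
  unfold conjW conjW₁ conjW₂
  abel

/-- **`hess_conj_invariant` IN an2's LETTERS**: with skew `X, X′`, the orthogonality jet relation, and the contacts written as
`Xᵀ𝕄 + 𝕄X` and the nine-term product-rule table. -/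
theorem hess_conj_invariant_transpose [DecidableEq F] {A M : MKer D F} (hA : Spr A) (hM : Spr M) (hAM : comp A M = idK)
    (hMA : comp M A = idK) {V Vp W X Xp X₂ : MKer D F} (hV : Loc V) (hVp : Loc Vp) (hW : Loc W) (hX : Loc X) (hXp : Loc Xp)
    (hX₂ : Loc X₂) (hskew : trK X = -X) (hskew' : trK Xp = -Xp) (horth : trK X₂ + X₂ + comp (trK X) Xp + comp (trK Xp) X = 0) :
    (1 / 2 : ℝ) * tadpole A (W + (comp (trK X) Vp + comp Vp X + comp (trK Xp) V + comp V Xp + comp (comp (trK X) M) Xp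
        + comp (comp (trK Xp) M) X + comp (trK X₂) M + comp M X₂))
      - (1 / 2 : ℝ) * bubble A (V + (comp (trK X) M + comp M X)) (Vp + (comp (trK Xp) M + comp M Xp))
      = (1 / 2 : ℝ) * tadpole A W - (1 / 2 : ℝ) * bubble A V Vp := by
  rw [conjW_eq_transpose hM hX hXp hX₂ hskew hskew' horth, conjV_eq_transpose M hskew, conjV_eq_transpose M hskew']
  exact hess_conj_invariant hA hM hAM hMA hV hVp hW hX hXp hX₂

/-! ## §4 Relabelling in `Loc` currency (`KernelReflection.comp_refK` / `tr_refK`) -/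

omit [Fintype F] in
/-- Per-leg trace slices of a localised kernel are summable. -/
theorem loc_summable_trSlice {K : MKer D F} (hK : Loc K) (a : F) : Summable fun x : Fin D → ℤ => K x x a a := by
  obtain ⟨p, q, C, δ, hδ, hK⟩ := hK
  exact summable_trSlice hK hδ a

/-- `tadpole (Φ·A) (Φ·W) = tadpole A W` for spread `A`, localised `W`. -/
theorem tadpole_refK_loc (Φ : LegMap D F) {A W : MKer D F} (hA : Spr A) (hW : Loc W) :
    tadpole (refK Φ A) (refK Φ W) = tadpole A W := by
  unfold ExpKernelCalculus.tadpole
  rw [comp_refK Φ (slice_tame hA.tame hW.tame)]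
  exact tr_refK Φ (loc_summable_trSlice (hA.comp_loc hW))

/-- `bubble (Φ·A) (Φ·V) (Φ·Z) = bubble A V Z` for spread `A`, localised `V`, `Z`. -/
theorem bubble_refK_loc (Φ : LegMap D F) {A V Z : MKer D F} (hA : Spr A) (hV : Loc V) (hZ : Loc Z) :
    bubble (refK Φ A) (refK Φ V) (refK Φ Z) = bubble A V Z := by
  unfold ExpKernelCalculus.bubble
  rw [comp_refK Φ (slice_tame hA.tame hV.tame), comp_refK Φ (slice_tame hA.tame hZ.tame),
    comp_refK Φ (slice_tame (hA.comp_loc hV).tame (hA.comp_loc hZ).tame)]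
  exact tr_refK Φ (loc_summable_trSlice ((hA.comp_loc hV).comp (hA.comp_loc hZ)))

end

end Summit.QuantumFields.BalabanUV.Beta.ChartConjugation
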